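import Mathlib
import Summits.ValiantsHypothesis.ValiantsHypothesis.Theorems.RigidityForcesSymmetryRankRigidMinimalReprLaplaceFiveSeparatedCaptureCommonLinePlane

/-!
# ValiantsHypothesis / RigidityForcesSymmetry — crux `LaplaceOptimalFive` (stmt-ValiantsHypothesis-24813), symmetric capture:
# ★★ **`CaptureIneqSym` FOR THREE PLANES THROUGH A COMMON LINE WITH A DIAGONAL ENTRY** (whole profile, no census)

Brick 3 (part 7) of the K1 lane (val-port-2 g6, 2026-08-29).  If the common line `u` has a nonzero diagonal entry `u_qq ≠ 0`, the
square-freeness space `K(u)` is `⊥` (Lemma κ), and the pencil-plus-plane count ✓ `finrank_le_prolong_add_plane_of_diag_ne_zero` reads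
`finrank W ≤ finrank prolong(U₀₁ ⊔ U₀₂) + finrank prolong U₁₂`; with `U₀₁ ⊔ U₀₂` of finrank ≤ 3 and `U₁₂` of finrank ≤ 2 the general
bounds ✓ `finrank_prolong_le_four` and ✓ `finrank_prolong_le_two` give `finrank W ≤ 4 + 2 = 6`.  So `CaptureIneqSym` holds for EVERY
configuration of three symmetric 2-planes `⟨u,a⟩, U₀₂, U₁₂` through a common line `u` with a nonzero diagonal entry (`a ∉ U₀₂`; no
prolongation, flatness or census hypothesis).

* ★★ `finrank_le_six_of_common_line_diag` — the count.
* ★★ `captureIneqSym_of_common_line_diag` — the `CaptureIneqSym` conclusion (`6 ≤ Σ finrank`, e.g. three 2-planes).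

Honest framing.  A profile cell: the zero-diagonal common line (κ(u) ≥ 1; census of record closes all samples by the typed leaves, the
classification is OPEN·located), `CaptureIneqSym` in general, K1 on `K₃ ⊔ K₂`, `LaplaceOptimalFive` (OPEN · CONTESTED 72/120),
`RankRigidMinimalRepr` and `VP ≠ VNP` are NOT proved here.  No definitions, no `sorry`.
-/

set_option linter.dupNamespace false
set_option autoImplicit false

namespace Summit.ValiantsHypothesis.ValiantsHypothesis.Theorems.RigidityForcesSymmetryRankRigidMinimalRepr

namespace LaplaceFiveSeparatedCapture

open Finset

/-- ★★ **COMMON LINE WITH A DIAGONAL ENTRY: `finrank W ≤ 6`.**  `U₀₁ = span {u, a}`, `u, a` symmetric, `u q q ≠ 0`, `u ∈ U₀₂ ∩ U₁₂`,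
`a ∉ U₀₂`, `U₀₂`, `U₁₂` symmetric of finrank ≤ 2.  Then every `W` of symmetric zero-diagonal leaf matrices captured by `L3 U₀₁ U₀₂ U₁₂` has
`finrank W ≤ 6` (✓ `finrank_le_prolong_add_plane_of_diag_ne_zero` + ✓ `finrank_prolong_le_four` + ✓ `finrank_prolong_le_two`). [folklore] -/
theorem finrank_le_six_of_common_line_diag (u a : Fin 5 → Fin 5 → ℂ) (hu : ∀ p q, u p q = u q p) (ha : ∀ p q, a p q = a q p)
    (q : Fin 5) (hq : u q q ≠ 0) (U02 U12 W : Submodule ℂ (Fin 5 → Fin 5 → ℂ))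
    (h02s : ∀ x ∈ U02, ∀ p q : Fin 5, x p q = x q p) (h12s : ∀ x ∈ U12, ∀ p q : Fin 5, x p q = x q p)
    (huU : u ∈ U02) (huU' : u ∈ U12) (haU : a ∉ U02)
    (h02 : Module.finrank ℂ U02 ≤ 2) (h12 : Module.finrank ℂ U12 ≤ 2)
    (hWs : ∀ μ ∈ W, ∀ s t : Fin 5, μ s t = μ t s) (hWd : ∀ μ ∈ W, ∀ s : Fin 5, μ s s = 0)
    (hWc : ∀ μ ∈ W, contractZ μ ∈ L3 (Submodule.span ℂ ({u, a} : Set (Fin 5 → Fin 5 → ℂ))) U02 U12) :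
    Module.finrank ℂ W ≤ 6 := by
  classical
  have h := finrank_le_prolong_add_plane_of_diag_ne_zero u a hu ha q hq U02 U12 W h02s h12s huU huU' haU hWs hWd hWc
  -- `span {u, a} ⊔ U02 = span {a} ⊔ U02` has finrank ≤ 3
  have hsup : Submodule.span ℂ ({u, a} : Set (Fin 5 → Fin 5 → ℂ)) ⊔ U02 ≤ Submodule.span ℂ ({a} : Set (Fin 5 → Fin 5 → ℂ)) ⊔ U02 := by
    refine sup_le ?_ le_sup_right
    rw [Submodule.span_le]
    intro x hx
    rcases hx with rfl | rfl
    · exact Submodule.mem_sup_right huU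
    · exact Submodule.mem_sup_left (Submodule.subset_span rfl)
  have h3 : Module.finrank ℂ ↥(Submodule.span ℂ ({u, a} : Set (Fin 5 → Fin 5 → ℂ)) ⊔ U02) ≤ 3 := by
    refine (Submodule.finrank_mono hsup).trans ?_
    refine (Submodule.finrank_add_le_finrank_add_finrank _ _).trans ?_
    have h1 : Module.finrank ℂ (Submodule.span ℂ ({a} : Set (Fin 5 → Fin 5 → ℂ))) ≤ 1 := by
      have h1' : Module.finrank ℂ (Submodule.span ℂ (↑({a} : Finset (Fin 5 → Fin 5 → ℂ)) : Set (Fin 5 → Fin 5 → ℂ))) ≤ 1 :=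
        (finrank_span_finset_le_card _).trans (Finset.card_singleton a).le
      have hset : (↑({a} : Finset (Fin 5 → Fin 5 → ℂ)) : Set (Fin 5 → Fin 5 → ℂ)) = {a} := Finset.coe_singleton a
      rw [hset] at h1'
      exact h1'
    omega
  -- symmetry of the 3-space
  have hPs : ∀ x ∈ Submodule.span ℂ ({u, a} : Set (Fin 5 → Fin 5 → ℂ)), ∀ p q : Fin 5, x p q = x q p := by
    intro x hx p q
    obtain ⟨c1, c2, rfl⟩ := Submodule.mem_span_pair.mp hx
    simp only [Pi.add_apply, Pi.smul_apply, smul_eq_mul, hu p q, ha p q]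
  have hXs : ∀ x ∈ Submodule.span ℂ ({u, a} : Set (Fin 5 → Fin 5 → ℂ)) ⊔ U02, ∀ p q : Fin 5, x p q = x q p := by
    intro x hx p q
    obtain ⟨y, hy, z, hz, rfl⟩ := Submodule.mem_sup.mp hx
    show y p q + z p q = y q p + z q p
    rw [hPs y hy p q, h02s z hz p q]
  have h4 := finrank_prolong_le_four _ hXs h3
  have h2 := finrank_prolong_le_two U12 h12s h12
  omega

/-- ★★ **`CaptureIneqSym` for three planes through a common line with a diagonal entry.**  As above, with the finranks adding up to at
least 6 (e.g. three 2-planes): `finrank W ≤ finrank U₀₁ + finrank U₀₂ + finrank U₁₂`. [folklore] -/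
theorem captureIneqSym_of_common_line_diag (u a : Fin 5 → Fin 5 → ℂ) (hu : ∀ p q, u p q = u q p) (ha : ∀ p q, a p q = a q p)
    (q : Fin 5) (hq : u q q ≠ 0) (U02 U12 W : Submodule ℂ (Fin 5 → Fin 5 → ℂ))
    (h02s : ∀ x ∈ U02, ∀ p q : Fin 5, x p q = x q p) (h12s : ∀ x ∈ U12, ∀ p q : Fin 5, x p q = x q p)
    (huU : u ∈ U02) (huU' : u ∈ U12) (haU : a ∉ U02)
    (h02 : Module.finrank ℂ U02 ≤ 2) (h12 : Module.finrank ℂ U12 ≤ 2)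
    (h6 : 6 ≤ Module.finrank ℂ (Submodule.span ℂ ({u, a} : Set (Fin 5 → Fin 5 → ℂ))) + Module.finrank ℂ U02
      + Module.finrank ℂ U12)
    (hWs : ∀ μ ∈ W, ∀ s t : Fin 5, μ s t = μ t s) (hWd : ∀ μ ∈ W, ∀ s : Fin 5, μ s s = 0)
    (hWc : ∀ μ ∈ W, contractZ μ ∈ L3 (Submodule.span ℂ ({u, a} : Set (Fin 5 → Fin 5 → ℂ))) U02 U12) :
    Module.finrank ℂ W ≤ Module.finrank ℂ (Submodule.span ℂ ({u, a} : Set (Fin 5 → Fin 5 → ℂ))) + Module.finrank ℂ U02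
      + Module.finrank ℂ U12 :=
  (finrank_le_six_of_common_line_diag u a hu ha q hq U02 U12 W h02s h12s huU huU' haU h02 h12 hWs hWd hWc).trans h6

end LaplaceFiveSeparatedCapture

end Summit.ValiantsHypothesis.ValiantsHypothesis.Theorems.RigidityForcesSymmetryRankRigidMinimalRepr
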